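import Mathlib
import Summits.Ventures.PercRepro2.TypedPocketABSupport
import Summits.Ventures.PercRepro2.TypedPocketOA2States

/-!
# The `{o, a₂}`-pocket class (HARRIS-2), III: the split and the states of the support (blind cell
PercRepro2, p3 g8, 2026-08-26; `proofs/P3-HARRIS.md` §6)

`SplitQ`: the doors `o, a₂` separate the pocket `WP ∋ b` from the far side `WF ∋ a₁, a₃` (every
open edge of the support within one side, the sides meeting only in the doors, no typed edge within
both).  The pocket state is `PocketAB.oStP ends b o a₂` (it records `o~b`, `a₂~b`, `o~a₂` inside
the pocket); the far state is `SepThree.bSt ends a₁ a₂ a₃ o` (the connections among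
`a₁, a₂, a₃, o` inside the far side).  The two-door closure lemmas give the seven coordinates and
`st_eq_harrisStQ`.  Own work; standard axioms.
-/

namespace Summit.Ventures.PercRepro2

open UnionCluster

namespace CovForm

namespace PocketOA2

open OneTyped TypedA3 Untouched TypedFactor Separated RootBridge SepThree

section Support

open Classical

variable {V : Type*} {E : Type*} [Fintype E] [DecidableEq E]
variable (ends : E → Sym2 V) (o a₁ a₂ a₃ b : V)

/-- **The `{o, a₂}`-pocket split**: the doors `o, a₂` separate the pocket `WP ∋ b` from the far
side `WF ∋ a₁, a₃` in the support `z ∪ F`. -/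
structure SplitQ (WP WF : Set V) (F : Finset E) (z : Config E) : Prop where
  split : ∀ e, zF F z e = true → e ∈ within ends WP ∨ e ∈ within ends WF
  cap : ∀ t, t ∈ WP → t ∈ WF → t = o ∨ t = a₂
  noloop : ∀ e ∈ F, ¬ (e ∈ within ends WP ∧ e ∈ within ends WF)
  bP : b ∈ WP
  oP : o ∈ WP
  oF : o ∈ WF
  a2P : a₂ ∈ WP
  a2F : a₂ ∈ WF
  a1F : a₁ ∈ WF
  a3F : a₃ ∈ WF
  bo : b ≠ o
  b2 : b ≠ a₂
  a1o : a₁ ≠ o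
  a12 : a₁ ≠ a₂
  a3o : a₃ ≠ o
  a32 : a₃ ≠ a₂

variable {ends o a₁ a₂ a₃ b}
variable {WP WF : Set V} {F : Finset E} {z : Config E}

omit [Fintype E] in
/-- A configuration below `z ∪ F` has its open edges within a side. -/
lemma split_of_le (h : SplitQ ends o a₁ a₂ a₃ b WP WF F z) {x : Config E} (hx : x ≤ zF F z) :
    ∀ e, x e = true → e ∈ within ends WP ∨ e ∈ within ends WF := fun e he =>
  h.split e (by have := hx e; rw [he] at this; exact Bool.eq_true_of_true_le this)

/-! ### The seven coordinates -/

section Coords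

variable (h : SplitQ ends o a₁ a₂ a₃ b WP WF F z) {x : Config E}
  (hsp : ∀ e, x e = true → e ∈ within ends WP ∨ e ∈ within ends WF)

omit [Fintype E] [DecidableEq E] in
include hsp in
/-- The split with the roles of the sides exchanged. -/
lemma hsp' : ∀ e, x e = true → e ∈ within ends WF ∨ e ∈ within ends WP := fun e he =>
  (hsp e he).symm

omit [Fintype E] in
include h in
/-- The doors from the far side. -/
lemma cap' : ∀ t, t ∈ WF → t ∈ WP → t = o ∨ t = a₂ := fun t h1 h2 => h.cap t h2 h1

omit [Fintype E] in
include h hsp in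
/-- `o ~ a₂ = X ∨ c₂`. -/
lemma conn_oa2 : Conn ends x o a₂ ↔
    Conn ends (withinRestr ends WP x) o a₂ ∨ Conn ends (withinRestr ends WF x) a₂ o := by
  rw [conn_doors ends hsp h.cap h.oP h.oF]
  constructor
  · rintro (hc | hc)
    · exact Or.inl hc
    · exact Or.inr (conn_symm hc)
  · rintro (hc | hc)
    · exact Or.inl hc
    · exact Or.inr (conn_symm hc)

omit [Fintype E] in
include h hsp in
/-- `a₂ ~ o = D`. -/
lemma conn_a2o : Conn ends x a₂ o ↔
    Conn ends (withinRestr ends WP x) o a₂ ∨ Conn ends (withinRestr ends WF x) a₂ o := by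
  rw [← conn_oa2 h hsp]
  exact ⟨conn_symm, conn_symm⟩

omit [Fintype E] in
include h hsp in
/-- `a₂ ~ a₁ = h₁₂ ∨ (D ∧ c₁)`. -/
lemma conn_a2a1 : Conn ends x a₂ a₁ ↔
    Conn ends (withinRestr ends WF x) a₂ a₁ ∨
      ((Conn ends (withinRestr ends WP x) o a₂ ∨ Conn ends (withinRestr ends WF x) a₂ o) ∧
        Conn ends (withinRestr ends WF x) a₁ o) := by
  have hin := conn_inside ends (hsp' hsp) (cap' h) h.oF h.oP h.a2F h.a2P h.a2F h.a1F
  rw [conn_oa2 h hsp] at hin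
  rw [hin]
  constructor
  · rintro (hc | ⟨hD, ⟨_, h21⟩ | ⟨_, ho1⟩⟩)
    · exact Or.inl hc
    · exact Or.inl h21
    · exact Or.inr ⟨hD, conn_symm ho1⟩
  · rintro (hc | ⟨hD, h1o⟩)
    · exact Or.inl hc
    · exact Or.inr ⟨hD, Or.inr ⟨conn_refl _ _ _, conn_symm h1o⟩⟩

omit [Fintype E] in
include h hsp in
/-- `a₁ ~ o = c₁ ∨ (D ∧ h₁₂)`. -/
lemma conn_a1o : Conn ends x a₁ o ↔
    Conn ends (withinRestr ends WF x) a₁ o ∨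
      ((Conn ends (withinRestr ends WP x) o a₂ ∨ Conn ends (withinRestr ends WF x) a₂ o) ∧
        Conn ends (withinRestr ends WF x) a₂ a₁) := by
  have hin := conn_inside ends (hsp' hsp) (cap' h) h.oF h.oP h.a2F h.a2P h.a1F h.oF
  rw [conn_oa2 h hsp] at hin
  rw [hin]
  constructor
  · rintro (hc | ⟨hD, ⟨h1o, _⟩ | ⟨h12, _⟩⟩)
    · exact Or.inl hc
    · exact Or.inl h1o
    · exact Or.inr ⟨hD, conn_symm h12⟩
  · rintro (hc | ⟨hD, h21⟩)
    · exact Or.inl hc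
    · exact Or.inr ⟨hD, Or.inr ⟨conn_symm h21, conn_refl _ _ _⟩⟩

omit [Fintype E] in
include h hsp in
/-- `a₁ ~ a₃ = Y ∨ (D ∧ ((c₁ ∧ h₃₂) ∨ (h₁₂ ∧ c₃)))`. -/
lemma conn_a1a3 : Conn ends x a₁ a₃ ↔
    Conn ends (withinRestr ends WF x) a₁ a₃ ∨
      ((Conn ends (withinRestr ends WP x) o a₂ ∨ Conn ends (withinRestr ends WF x) a₂ o) ∧
        ((Conn ends (withinRestr ends WF x) a₁ o ∧ Conn ends (withinRestr ends WF x) a₂ a₃) ∨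
          (Conn ends (withinRestr ends WF x) a₂ a₁ ∧ Conn ends (withinRestr ends WF x) a₃ o))) := by
  have hin := conn_inside ends (hsp' hsp) (cap' h) h.oF h.oP h.a2F h.a2P h.a1F h.a3F
  rw [conn_oa2 h hsp] at hin
  rw [hin]
  constructor
  · rintro (hc | ⟨hD, ⟨h1o, h23⟩ | ⟨h12, ho3⟩⟩)
    · exact Or.inl hc
    · exact Or.inr ⟨hD, Or.inl ⟨h1o, h23⟩⟩
    · exact Or.inr ⟨hD, Or.inr ⟨conn_symm h12, conn_symm ho3⟩⟩
  · rintro (hc | ⟨hD, ⟨h1o, h23⟩ | ⟨h21, h3o⟩⟩)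
    · exact Or.inl hc
    · exact Or.inr ⟨hD, Or.inl ⟨h1o, h23⟩⟩
    · exact Or.inr ⟨hD, Or.inr ⟨conn_symm h21, conn_symm h3o⟩⟩

omit [Fintype E] in
include h hsp in
/-- `a₂ ~ a₃ = h₃₂ ∨ (D ∧ c₃)`. -/
lemma conn_a2a3 : Conn ends x a₂ a₃ ↔
    Conn ends (withinRestr ends WF x) a₂ a₃ ∨
      ((Conn ends (withinRestr ends WP x) o a₂ ∨ Conn ends (withinRestr ends WF x) a₂ o) ∧
        Conn ends (withinRestr ends WF x) a₃ o) := by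
  have hin := conn_inside ends (hsp' hsp) (cap' h) h.oF h.oP h.a2F h.a2P h.a2F h.a3F
  rw [conn_oa2 h hsp] at hin
  rw [hin]
  constructor
  · rintro (hc | ⟨hD, ⟨_, h23⟩ | ⟨_, ho3⟩⟩)
    · exact Or.inl hc
    · exact Or.inl h23
    · exact Or.inr ⟨hD, conn_symm ho3⟩
  · rintro (hc | ⟨hD, h3o⟩)
    · exact Or.inl hc
    · exact Or.inr ⟨hD, Or.inr ⟨conn_refl _ _ _, conn_symm h3o⟩⟩

omit [Fintype E] in
include h hsp in
/-- `a₂ ~ b = p₂ ∨ (D ∧ p_o)`. -/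
lemma conn_a2b : Conn ends x a₂ b ↔
    Conn ends (withinRestr ends WP x) a₂ b ∨
      ((Conn ends (withinRestr ends WP x) o a₂ ∨ Conn ends (withinRestr ends WF x) a₂ o) ∧
        Conn ends (withinRestr ends WP x) o b) := by
  have hin := conn_inside ends hsp h.cap h.oP h.oF h.a2P h.a2F h.a2P h.bP
  rw [conn_oa2 h hsp] at hin
  rw [hin]
  constructor
  · rintro (hc | ⟨hD, ⟨_, h2b⟩ | ⟨_, hob⟩⟩)
    · exact Or.inl hc
    · exact Or.inl h2b
    · exact Or.inr ⟨hD, hob⟩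
  · rintro (hc | ⟨hD, hob⟩)
    · exact Or.inl hc
    · exact Or.inr ⟨hD, Or.inr ⟨conn_refl _ _ _, hob⟩⟩

omit [Fintype E] in
include h hsp in
/-- `o ~ b = p_o ∨ (D ∧ p₂)`. -/
lemma conn_ob : Conn ends x o b ↔
    Conn ends (withinRestr ends WP x) o b ∨
      ((Conn ends (withinRestr ends WP x) o a₂ ∨ Conn ends (withinRestr ends WF x) a₂ o) ∧
        Conn ends (withinRestr ends WP x) a₂ b) := by
  have hin := conn_inside ends hsp h.cap h.oP h.oF h.a2P h.a2F h.oP h.bP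
  rw [conn_oa2 h hsp] at hin
  rw [hin]
  constructor
  · rintro (hc | ⟨hD, ⟨_, h2b⟩ | ⟨_, hob⟩⟩)
    · exact Or.inl hc
    · exact Or.inr ⟨hD, h2b⟩
    · exact Or.inl hob
  · rintro (hc | ⟨hD, h2b⟩)
    · exact Or.inl hc
    · exact Or.inr ⟨hD, Or.inl ⟨conn_refl _ _ _, h2b⟩⟩

omit [Fintype E] in
include h hsp in
/-- `a₁ ~ b` through a door: `(a₁~o ∧ o~b) ∨ (a₂~a₁ ∧ a₂~b)`. -/
lemma conn_a1b : Conn ends x a₁ b ↔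
    (Conn ends x a₁ o ∧ Conn ends x o b) ∨ (Conn ends x a₂ a₁ ∧ Conn ends x a₂ b) := by
  have hbF : b ∉ WF := fun hbF => by
    rcases h.cap b h.bP hbF with ho | h2
    · exact h.bo ho
    · exact h.b2 h2
  constructor
  · intro hc
    rcases conn_door ends (hsp' hsp) (cap' h) h.a1F hbF hc with ⟨h1o, hob⟩ | ⟨h12, h2b⟩
    · exact Or.inl ⟨h1o, hob⟩
    · exact Or.inr ⟨conn_symm h12, h2b⟩
  · rintro (⟨h1o, hob⟩ | ⟨h21, h2b⟩)
    · exact conn_trans h1o hob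
    · exact conn_trans (conn_symm h21) h2b

end Coords

omit [Fintype E] in
/-- **The state of a copy of the support is the gluing of its side states.** -/
theorem st_eq_harrisStQ (h : SplitQ ends o a₁ a₂ a₃ b WP WF F z) {x : Config E}
    (hx : x ≤ zF F z) :
    st ends o a₁ a₂ a₃ b x =
      gluedQ (PocketAB.oStP ends b o a₂ WP x) (bSt ends a₁ a₂ a₃ o WF x) := by
  have hsp := split_of_le h hx
  have e1 := conn_a2a1 h hsp
  have e2 := conn_a1o h hsp
  have e3 := conn_a2o h hsp
  have e4 := conn_a1b h hsp
  have e5 := conn_a2b h hsp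
  have e6 := conn_a1a3 h hsp
  have e7 := conn_a2a3 h hsp
  have e9 := conn_ob h hsp
  rw [e2, e9, e1, e5] at e4
  unfold st gluedQ PocketAB.oStP bSt
  rw [decide_eq_decide.mpr e1, decide_eq_decide.mpr e2, decide_eq_decide.mpr e3,
    decide_eq_decide.mpr e4, decide_eq_decide.mpr e5, decide_eq_decide.mpr e6,
    decide_eq_decide.mpr e7]
  simp only [Bool.decide_or, Bool.decide_and]
  all_goals infer_instance

end Support

end PocketOA2

end CovForm

end Summit.Ventures.PercRepro2
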